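import Mathlib.LinearAlgebra.RootSystem.Base
import Mathlib.Algebra.Lie.Subalgebra
import Mathlib.Algebra.Lie.OfAssociative
import Mathlib.Data.Matrix.Block
import Mathlib.GroupTheory.Torsion
import Literature.NumberTheory.Automorphic.WeightTorus
import HarnessLib

/-!
# Infinitesimal data for Chevalley's existence theorem: graded root matrices
(Springer 10.2.5–10.2.7, representation-theoretic form)

Trunk T-AUTOMORPHIC (G25 AutomorphicL); towards Chevalley's existence theorem
`Literature.NumberTheory.Automorphic.chevalley_existence` /
`Literature.NumberTheory.Automorphic.chevalley_existence_based` (Springer, *Linear Algebraic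
Groups*, 2nd ed., 10.1.1) in the concrete `k`-points vocabulary of `LinearAlgebraicGroups.lean`.
Springer constructs the adjoint simply-laced groups as `G = ⟨T, U_α⟩ ≤ GL(𝔤)` from an explicit
Lie algebra `𝔤 = 𝔱 ⊕ ∑ k e_α` with `T` the torus of character group `Q` acting through the
roots and `U_α = {exp (x ad e_α)}` (10.2.5–10.2.7), and reduces the general case to this one by
coverings (10.1.3) and folding (10.3). We replace the adjoint representation by an arbitrary
finite-dimensional one and isolate, in this file, the **linear-algebra input** of the group
construction: a family of *blocks* `V_j = k^{n_j}` with

* a weight basis, i.e. weights `wt : n_j → X` in the character lattice `X` of the root datum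
  `P = (X, R, Y, R^∨)` (the torus will be the weight torus `T_X` of `WeightTorus.lean`);
* for every root `α = P.root i` a matrix `E i` which is *homogeneous of degree `α`* for the
  `X`-grading of `𝔤𝔩(V)` defined by the weights (`IsHomogMat`), the root vector;
* the `𝔰𝔩₂`-relation `[E_α, E_{-α}] = H_α`, where `H_α = torusDiag wt ⟨·, α^∨⟩` acts on the
  weight space `V_x` by the integer `⟨x, α^∨⟩` (Springer 10.2.5: `[e_α, e_{-α}] = 1 ⊗ α^∨`);
* irreducibility of each block under the root matrices and the diagonal torus Lie algebra
  `𝔱_V = {torusDiag wt ℓ | ℓ ∈ Hom(X, k)}`, block weights congruent modulo the root lattice and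
  block weight sums orthogonal to all coroots;

and, for the family (`RootRep`): the weights generate `X`, distinct blocks are told apart by a
weight, the span `𝔤_V = 𝔱_V + ∑ k E_α` is closed under brackets and generated, as a Lie
algebra, by `𝔱_V` and the `E_{±α}` for `α` simple (for a base `b` of `P`). This is exactly what
a faithful finite-dimensional representation of the split reductive Lie algebra with root datum
`P` provides (constructed in the sequel from Mathlib's `RootPairing.GeckConstruction`); the group
`G = ⟨T_X, exp (x E_α)⟩` and the verification of `IsRootDatumOf` are the subject of the
companion files `ChevalleyGroup*.lean`.

Proved here (everything is elementary linear algebra):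

* `IsHomogMat` calculus: homogeneous components (`homogComp`), products, powers, brackets
  with `torusDiag` (`[D_ℓ, A] = ℓ(ξ) A`,
  `torusDiag_mul_sub_mul_torusDiag`), conjugation by weight-torus elements
  (`diagonal_mul_mul_diagonal_inv_of_isHomogMat`: `t A t⁻¹ = χ(ξ) A`), and **nilpotency of
  homogeneous matrices of non-zero degree** (`IsHomogMat.isNilpotent`: the degrees `r • ξ` of
  the powers are pairwise distinct in the torsion-free `X` while only finitely many differences
  of weights occur);
* for a block: the `𝔰𝔩₂`-relations `[H_α, E_{±α}] = ±2 E_{±α}` (`RootRepBlock.hMat_mul_E_sub`);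
* for a family: the global (block-diagonal) root matrices `RootRep.E` are homogeneous, satisfy
  `[E_α, E_{-α}] = H_α`, are nilpotent, and are **non-zero** (`RootRep.E_ne_zero`: otherwise
  `⟨x, α^∨⟩ = 0` for all weights `x`, which generate `X`, contradicting `⟨α, α^∨⟩ = 2`).

## Mathlib

`Matrix.blockDiagonal'` (with `_mul`, `_diagonal`, `_apply_eq/_ne`), `Matrix.diagonal`,
`RootPairing` (`root_coroot_two`, `coroot'`, reflexivity `Module.IsReflexive.of_isPerfPair`
giving torsion-freeness of `X`), `LieSubalgebra.lieSpan`, `AddMonoidHom.instModule`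
(`Hom(X, k)` as a `k`-vector space). Mathlib has no linear algebraic groups; nothing here
duplicates a Mathlib declaration (the `X`-grading of matrices by a weight function is ad hoc and
kept as a predicate).

## References

* [SpringerLAG1998] T. A. Springer, *Linear Algebraic Groups*, 2nd ed., Progress in Mathematics 9,
  Birkhäuser (1998): 10.1.1, 10.2.5–10.2.8.
* R. Steinberg, *Lectures on Chevalley groups*, Yale (1968), §3 (the groups `⟨exp (x X_α)⟩` in a
  representation), §5.
-/

noncomputable section

open scoped MatrixGroups

namespace Literature.NumberTheory.Automorphic

attribute [local instance 100] LieRing.ofAssociativeRing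

variable {k : Type*} [Field k]
variable {ι X Y : Type*} [AddCommGroup X] [AddCommGroup Y]
variable {n : Type*}

/-! ### The `X`-grading of `𝔤𝔩ₙ` defined by a weight basis -/

section Graded

variable (wt : n → X)

/-- A matrix `A` is *homogeneous of degree `ξ`* for the weights `wt` if it maps the basis vector
`e_c` (weight `wt c`) into the span of the `e_a` with `wt a = wt c + ξ`, i.e. `A a c ≠ 0` forces
`wt a = wt c + ξ` (the `X`-grading `𝔤𝔩(V) = ⊕_ξ 𝔤𝔩(V)_ξ` of a graded vector space).
[folklore] -/
def IsHomogMat (ξ : X) (A : Matrix n n k) : Prop :=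
  ∀ a c, A a c ≠ 0 → wt a = wt c + ξ

variable {wt}

/-- The zero matrix is homogeneous of every degree. [folklore] -/
lemma isHomogMat_zero (ξ : X) : IsHomogMat wt ξ (0 : Matrix n n k) := fun _ _ h => (h rfl).elim

/-- Homogeneous matrices of a fixed degree form a subspace: sums. [folklore] -/
lemma IsHomogMat.add {ξ : X} {A B : Matrix n n k} (hA : IsHomogMat wt ξ A)
    (hB : IsHomogMat wt ξ B) : IsHomogMat wt ξ (A + B) := by
  intro a c h
  by_cases ha : A a c = 0
  · exact hB a c (by simpa [ha] using h)
  · exact hA a c ha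

/-- Homogeneous matrices of a fixed degree form a subspace: scalar multiples. [folklore] -/
lemma IsHomogMat.smul {ξ : X} {A : Matrix n n k} (hA : IsHomogMat wt ξ A) (x : k) :
    IsHomogMat wt ξ (x • A) := fun a c h => hA a c (by
  intro h0; exact h (by simp [h0]))

/-- Negation preserves homogeneity. [folklore] -/
lemma IsHomogMat.neg {ξ : X} {A : Matrix n n k} (hA : IsHomogMat wt ξ A) :
    IsHomogMat wt ξ (-A) := fun a c h => hA a c (by simpa using h)

/-- Differences of homogeneous matrices of the same degree. [folklore] -/
lemma IsHomogMat.sub {ξ : X} {A B : Matrix n n k} (hA : IsHomogMat wt ξ A)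
    (hB : IsHomogMat wt ξ B) : IsHomogMat wt ξ (A - B) := by
  rw [sub_eq_add_neg]; exact hA.add hB.neg

/-- **A homogeneous matrix of two different degrees is zero** wherever the degrees differ — in
particular a matrix homogeneous of two distinct degrees vanishes. [folklore] -/
lemma IsHomogMat.eq_zero_of_ne {ξ ξ' : X} {A : Matrix n n k} (hA : IsHomogMat wt ξ A)
    (hA' : IsHomogMat wt ξ' A) (h : ξ ≠ ξ') : A = 0 := by
  ext a c
  by_contra hac
  exact h (add_left_cancel ((hA a c hac).symm.trans (hA' a c hac)))

/-! ### Homogeneous components -/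

variable (wt) in
open Classical in
/-- The homogeneous component of degree `ξ` of a matrix: keep the entries `A a c` with
`wt a = wt c + ξ`. [folklore] -/
def homogComp (ξ : X) (A : Matrix n n k) : Matrix n n k :=
  Matrix.of fun a c => if wt a = wt c + ξ then A a c else 0

open Classical in
/-- Entries of the homogeneous component. [folklore] -/
lemma homogComp_apply (ξ : X) (A : Matrix n n k) (a c : n) :
    homogComp wt ξ A a c = if wt a = wt c + ξ then A a c else 0 := rfl

/-- The homogeneous component is homogeneous. [folklore] -/
lemma isHomogMat_homogComp (ξ : X) (A : Matrix n n k) : IsHomogMat wt ξ (homogComp wt ξ A) := by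
  intro a c h
  rw [homogComp_apply] at h
  by_contra hne
  exact h (if_neg hne)

/-- A homogeneous matrix is its own component. [folklore] -/
lemma IsHomogMat.homogComp_eq_self {ξ : X} {A : Matrix n n k} (hA : IsHomogMat wt ξ A) :
    homogComp wt ξ A = A := by
  ext a c
  rw [homogComp_apply]
  split_ifs with h
  · rfl
  · by_contra hac
    exact h (hA a c (Ne.symm hac))

/-- The component of degree `ξ` of a homogeneous matrix of another degree vanishes. [folklore] -/
lemma IsHomogMat.homogComp_eq_zero {ξ ξ' : X} {A : Matrix n n k} (hA : IsHomogMat wt ξ' A)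
    (h : ξ' ≠ ξ) : homogComp wt ξ A = 0 := by
  ext a c
  rw [homogComp_apply, Matrix.zero_apply]
  split_ifs with h'
  · by_contra hac
    exact h (add_left_cancel ((hA a c hac).symm.trans h'))
  · rfl

/-- Taking homogeneous components is additive. [folklore] -/
lemma homogComp_add (ξ : X) (A B : Matrix n n k) :
    homogComp wt ξ (A + B) = homogComp wt ξ A + homogComp wt ξ B := by
  ext a c
  simp only [homogComp_apply, Matrix.add_apply]
  split_ifs <;> simp

/-- Taking homogeneous components is homogeneous. [folklore] -/
lemma homogComp_smul (ξ : X) (x : k) (A : Matrix n n k) :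
    homogComp wt ξ (x • A) = x • homogComp wt ξ A := by
  ext a c
  simp only [homogComp_apply, Matrix.smul_apply]
  split_ifs <;> simp

/-- Taking homogeneous components commutes with subtraction. [folklore] -/
lemma homogComp_sub (ξ : X) (A B : Matrix n n k) :
    homogComp wt ξ (A - B) = homogComp wt ξ A - homogComp wt ξ B := by
  ext a c
  simp only [homogComp_apply, Matrix.sub_apply]
  split_ifs <;> simp

/-- Taking homogeneous components commutes with finite sums. [folklore] -/
lemma homogComp_sum {ι' : Type*} (ξ : X) (s : Finset ι') (A : ι' → Matrix n n k) :
    homogComp wt ξ (∑ i ∈ s, A i) = ∑ i ∈ s, homogComp wt ξ (A i) := by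
  classical
  induction s using Finset.induction_on with
  | empty => ext a c; simp [homogComp_apply]
  | insert i s hi ih => rw [Finset.sum_insert hi, Finset.sum_insert hi, homogComp_add, ih]

variable [DecidableEq n]

/-- A diagonal matrix is homogeneous of degree `0`. [folklore] -/
lemma isHomogMat_diagonal (d : n → k) : IsHomogMat wt 0 (Matrix.diagonal d) := by
  intro a c h
  by_cases hac : a = c
  · subst hac; simp
  · exact (h (Matrix.diagonal_apply_ne d hac)).elim

variable (wt)

/-- The diagonal matrix `D_ℓ = diag (ℓ (wt a))ₐ` attached to an additive map `ℓ : X → k`: the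
action of `ℓ ∈ Hom(X, k) = Lie (T_X)` on the graded space (Springer 10.2.5: `[u, e_α] = ⟨α, u⟩ e_α`
for `u ∈ 𝔱 = k ⊗ Q^∨`). [folklore] -/
def torusDiag (ℓ : X →+ k) : Matrix n n k := Matrix.diagonal fun a => ℓ (wt a)

/-- `torusDiag` is `k`-linear in `ℓ`. [folklore] -/
def torusDiagLin : (X →+ k) →ₗ[k] Matrix n n k where
  toFun := torusDiag wt
  map_add' ℓ ℓ' := by
    simp only [torusDiag, AddMonoidHom.add_apply, Matrix.diagonal_add]
  map_smul' x ℓ := by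
    simp only [torusDiag, AddMonoidHom.smul_apply, RingHom.id_apply]
    rw [← Matrix.diagonal_smul]
    rfl

/-- The *torus Lie algebra* `𝔱_V = {D_ℓ | ℓ ∈ Hom(X, k)} ≤ 𝔤𝔩ₙ` of the weight basis (it will be
the Lie algebra of the weight torus `T_X`). [folklore] -/
def torusLie : Submodule k (Matrix n n k) := LinearMap.range (torusDiagLin wt)

variable {wt}

/-- Unfolding of `torusDiagLin`. [folklore] -/
@[simp] lemma torusDiagLin_apply (ℓ : X →+ k) : torusDiagLin wt ℓ = torusDiag wt ℓ := rfl

/-- Entries of `torusDiag`. [folklore] -/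
lemma torusDiag_apply (ℓ : X →+ k) (a c : n) :
    torusDiag wt ℓ a c = if a = c then ℓ (wt a) else 0 := by
  simp [torusDiag, Matrix.diagonal_apply]

/-- Membership in `torusLie`. [folklore] -/
lemma mem_torusLie_iff {A : Matrix n n k} : A ∈ torusLie wt ↔ ∃ ℓ : X →+ k, torusDiag wt ℓ = A :=
  LinearMap.mem_range

/-- `D_ℓ ∈ 𝔱_V`. [folklore] -/
lemma torusDiag_mem_torusLie (ℓ : X →+ k) : torusDiag wt ℓ ∈ torusLie wt := ⟨ℓ, rfl⟩

/-- `D_ℓ` is homogeneous of degree `0`. [folklore] -/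
lemma isHomogMat_torusDiag (ℓ : X →+ k) : IsHomogMat wt 0 (torusDiag wt ℓ) :=
  isHomogMat_diagonal _

variable [Fintype n]

omit [DecidableEq n] in
/-- **Degrees add under products.** [folklore] -/
lemma IsHomogMat.mul {ξ ξ' : X} {A B : Matrix n n k} (hA : IsHomogMat wt ξ A)
    (hB : IsHomogMat wt ξ' B) : IsHomogMat wt (ξ + ξ') (A * B) := by
  intro a c h
  rw [Matrix.mul_apply] at h
  obtain ⟨e, -, he⟩ := Finset.exists_ne_zero_of_sum_ne_zero h
  have hA' : A a e ≠ 0 := fun h0 => he (by simp [h0])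
  have hB' : B e c ≠ 0 := fun h0 => he (by simp [h0])
  rw [hA a e hA', hB e c hB']
  abel

/-- Degrees of powers. [folklore] -/
lemma IsHomogMat.pow {ξ : X} {A : Matrix n n k} (hA : IsHomogMat wt ξ A) (r : ℕ) :
    IsHomogMat wt (r • ξ) (A ^ r) := by
  induction r with
  | zero =>
    intro a c h
    rw [pow_zero] at h
    by_cases hac : a = c
    · subst hac; simp
    · exact (h (Matrix.one_apply_ne hac)).elim
  | succ r ih =>
    rw [pow_succ, succ_nsmul]
    exact ih.mul hA

/-- **`[D_ℓ, A] = ℓ(ξ) A` for `A` homogeneous of degree `ξ`** (Springer 10.2.5,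
`[u, e_α] = ⟨α, u⟩ e_α`). [folklore] -/
theorem torusDiag_mul_sub_mul_torusDiag {ξ : X} {A : Matrix n n k} (hA : IsHomogMat wt ξ A)
    (ℓ : X →+ k) : torusDiag wt ℓ * A - A * torusDiag wt ℓ = ℓ ξ • A := by
  ext a c
  simp only [torusDiag, Matrix.sub_apply, Matrix.diagonal_mul, Matrix.mul_diagonal,
    Matrix.smul_apply, smul_eq_mul]
  by_cases hac : A a c = 0
  · simp [hac]
  · rw [hA a c hac, map_add]
    ring

/-- `D_ℓ` commutes with every matrix of degree `0`, in particular with every `D_ℓ'`. [folklore] -/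
lemma torusDiag_mul_eq_mul_torusDiag_of_isHomogMat_zero {A : Matrix n n k}
    (hA : IsHomogMat wt 0 A) (ℓ : X →+ k) : torusDiag wt ℓ * A = A * torusDiag wt ℓ := by
  have h := torusDiag_mul_sub_mul_torusDiag hA ℓ
  rwa [map_zero, zero_smul, sub_eq_zero] at h

/-- **Conjugating a homogeneous matrix by a weight-torus element**: for a character `χ` of `X`
and `A` of degree `ξ`, `diag (χ (wt a)) · A · diag (χ (wt a))⁻¹ = χ(ξ) A` (Springer 10.2.7:
`t . e_α = α(t) e_α`). [folklore] -/
theorem diagonal_mul_mul_diagonal_inv_of_isHomogMat {ξ : X} {A : Matrix n n k}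
    (hA : IsHomogMat wt ξ A) (χ : Multiplicative X →* kˣ) :
    (Matrix.diagonal fun a => (χ (Multiplicative.ofAdd (wt a)) : k)) * A *
        (Matrix.diagonal fun a => (((χ (Multiplicative.ofAdd (wt a)))⁻¹ : kˣ) : k)) =
      (χ (Multiplicative.ofAdd ξ) : k) • A := by
  ext a c
  simp only [Matrix.mul_diagonal, Matrix.diagonal_mul, Matrix.smul_apply, smul_eq_mul]
  by_cases hac : A a c = 0
  · simp [hac]
  · have hw : wt a = wt c + ξ := hA a c hac
    have hχ : (χ (Multiplicative.ofAdd (wt a)) : k) =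
        χ (Multiplicative.ofAdd (wt c)) * χ (Multiplicative.ofAdd ξ) := by
      rw [hw, ofAdd_add, map_mul, Units.val_mul]
    rw [hχ, Units.val_inv_eq_inv_val]
    have hc : (χ (Multiplicative.ofAdd (wt c)) : k) ≠ 0 := Units.ne_zero _
    field_simp

/-- **Homogeneous matrices of non-zero degree are nilpotent** (for torsion-free `X`): the power
`A ^ r` has degree `r • ξ`, these degrees are pairwise distinct, while a non-zero entry of `A ^ r`
exhibits `r • ξ` as one of the finitely many differences `wt a - wt c`. [folklore] -/
theorem IsHomogMat.isNilpotent [IsAddTorsionFree X] {ξ : X} {A : Matrix n n k}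
    (hA : IsHomogMat wt ξ A) (hξ : ξ ≠ 0) : IsNilpotent A := by
  classical
  -- the finite set of differences of weights
  let S : Finset X := Finset.univ.image fun p : n × n => wt p.1 - wt p.2
  -- some multiple `r • ξ`, `r ≤ |S|`, is not a difference of weights
  have hinj : Function.Injective fun r : ℕ => r • ξ := by
    intro r s hrs
    change r • ξ = s • ξ at hrs
    by_contra hne
    rcases Nat.lt_or_gt_of_ne hne with hlt | hlt
    · have h0 : (s - r) • ξ = (s - r) • (0 : X) := by
        rw [nsmul_zero, sub_nsmul _ hlt.le, ← hrs]
        abel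
      exact hξ (IsAddTorsionFree.nsmul_right_injective (Nat.sub_ne_zero_of_lt hlt) h0)
    · have h0 : (r - s) • ξ = (r - s) • (0 : X) := by
        rw [nsmul_zero, sub_nsmul _ hlt.le, hrs]
        abel
      exact hξ (IsAddTorsionFree.nsmul_right_injective (Nat.sub_ne_zero_of_lt hlt) h0)
  obtain ⟨r, -, hr⟩ : ∃ r ∈ Finset.range (S.card + 1), r • ξ ∉ S := by
    by_contra hcon
    push Not at hcon
    have hsub : (Finset.range (S.card + 1)).image (fun r : ℕ => r • ξ) ⊆ S := by
      intro x hx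
      obtain ⟨r, hr, rfl⟩ := Finset.mem_image.mp hx
      exact hcon r hr
    have hcard := Finset.card_le_card hsub
    rw [Finset.card_image_of_injective _ hinj, Finset.card_range] at hcard
    omega
  refine ⟨r, ?_⟩
  ext a c
  by_contra hac
  apply hr
  have h := hA.pow r a c hac
  exact Finset.mem_image.mpr ⟨(a, c), Finset.mem_univ _, by rw [h]; abel⟩

end Graded

/-! ### The coroot forms and the matrices `H_α` -/

section Coroot

variable (P : RootPairing ι ℤ X Y) (wt : n → X)

/-- The additive map `x ↦ ⟨x, α_i^∨⟩ ∈ ℤ ⊆ k` defined by the coroot `α_i^∨`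
(Mathlib `RootPairing.coroot'`, cast to `k`). [folklore] -/
def corootForm (i : ι) : X →+ k :=
  (Int.castAddHom k).comp (P.coroot' i).toAddMonoidHom

/-- Unfolding of `corootForm`. [folklore] -/
@[simp] lemma corootForm_apply (i : ι) (x : X) :
    corootForm (k := k) P i x = ((P.toLinearMap x (P.coroot i) : ℤ) : k) := rfl

variable [DecidableEq n]

/-- The matrix `H_α = diag (⟨wt a, α^∨⟩)ₐ` of the coroot `α^∨ = P.coroot i` on the weight basis
(Springer 10.2.5: `1 ⊗ α^∨ ∈ 𝔱` acts on the weight-`x` space by `⟨x, α^∨⟩`). [folklore] -/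
def hMat (i : ι) : Matrix n n k := torusDiag wt (corootForm P i)

/-- `H_α ∈ 𝔱_V`. [folklore] -/
lemma hMat_mem_torusLie (i : ι) : hMat (k := k) P wt i ∈ torusLie wt :=
  torusDiag_mem_torusLie _

/-- Entries of `H_α`. [folklore] -/
lemma hMat_apply (i : ι) (a c : n) :
    hMat (k := k) P wt i a c = if a = c then ((P.toLinearMap (wt a) (P.coroot i) : ℤ) : k) else 0 :=
  torusDiag_apply _ a c

/-- `⟨α, α^∨⟩ = 2` through `corootForm`. [folklore] -/
lemma corootForm_root_self (i : ι) : corootForm (k := k) P i (P.root i) = 2 := by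
  rw [corootForm_apply]
  have h : P.toLinearMap (P.root i) (P.coroot i) = 2 := P.root_coroot_two i
  rw [h]; norm_num

/-- `⟨-α, α^∨⟩ = -2`. [folklore] -/
lemma corootForm_neg_root_self (i : ι) : corootForm (k := k) P i (-P.root i) = -2 := by
  rw [map_neg, corootForm_root_self]

variable [Fintype n]

variable {wt} in
/-- **`[H_α, A] = ⟨ξ, α^∨⟩ A`** for `A` of degree `ξ`. [folklore] -/
lemma hMat_mul_sub_mul_hMat {ξ : X} {A : Matrix n n k} (hA : IsHomogMat wt ξ A) (i : ι) :
    hMat P wt i * A - A * hMat P wt i = corootForm (k := k) P i ξ • A :=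
  torusDiag_mul_sub_mul_torusDiag hA _

end Coroot

/-! ### One block of root matrices -/

/-- **A block of root matrices** for the root datum `P` over `k` on `V = kⁿ`: a weight basis
(`wt`), root matrices `E i` homogeneous of degree `P.root i` with `[E_α, E_{-α}] = H_α`
(`-α = P.root (P.reflectionPerm i i)`), such that `V` is *irreducible* under the `E_α` and the
torus Lie algebra `𝔱_V`, all weights of the block are congruent modulo the root lattice, and the
sum of the weights is orthogonal to every coroot (it is a `W`-invariant element of `X`). This is
what an irreducible constituent of a faithful representation of the split reductive Lie algebra
with root datum `P` looks like on a weight basis (Springer 10.2.5–10.2.7 for the adjoint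
representation; Steinberg, *Lectures on Chevalley groups*, §3 in general). [folklore] -/
structure RootRepBlock (k : Type*) [Field k] (P : RootPairing ι ℤ X Y) (n : Type*) [Fintype n]
    [DecidableEq n] where
  /-- The weights of the basis vectors. -/
  wt : n → X
  /-- The root matrices. -/
  E : ι → Matrix n n k
  /-- `E i` is homogeneous of degree `P.root i`. -/
  isHomogMat_E : ∀ i, IsHomogMat wt (P.root i) (E i)
  /-- `[E_α, E_{-α}] = H_α`. -/
  E_mul_E_neg_sub : ∀ i,
    E i * E (P.reflectionPerm i i) - E (P.reflectionPerm i i) * E i = hMat P wt i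
  /-- The block is irreducible under the root matrices and the torus Lie algebra. -/
  irreducible : ∀ W : Submodule k (n → k),
    (∀ i, ∀ v ∈ W, (E i).mulVec v ∈ W) → (∀ ℓ : X →+ k, ∀ v ∈ W, (torusDiag wt ℓ).mulVec v ∈ W) →
      W = ⊥ ∨ W = ⊤
  /-- All weights of the block are congruent modulo the root lattice. -/
  wt_sub_wt_mem : ∀ a c, wt a - wt c ∈ AddSubgroup.closure (Set.range P.root)
  /-- The sum of the weights of the block is orthogonal to all coroots. -/
  sum_wt_coroot : ∀ i, P.toLinearMap (∑ a, wt a) (P.coroot i) = 0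

namespace RootRepBlock

variable [Fintype n] [DecidableEq n] {P : RootPairing ι ℤ X Y} (B : RootRepBlock k P n)

/-- `[H_α, E_α] = 2 E_α`. [folklore] -/
lemma hMat_mul_E_sub (i : ι) :
    hMat P B.wt i * B.E i - B.E i * hMat P B.wt i = (2 : k) • B.E i := by
  rw [hMat_mul_sub_mul_hMat P (B.isHomogMat_E i), corootForm_root_self]

/-- `[H_α, E_{-α}] = -2 E_{-α}`. [folklore] -/
lemma hMat_mul_E_neg_sub (i : ι) :
    hMat P B.wt i * B.E (P.reflectionPerm i i) - B.E (P.reflectionPerm i i) * hMat P B.wt i =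
      (-2 : k) • B.E (P.reflectionPerm i i) := by
  rw [hMat_mul_sub_mul_hMat P (B.isHomogMat_E _), P.root_reflectionPerm,
    P.reflection_apply_self, corootForm_neg_root_self]

/-- The root matrices of a block are nilpotent (they have non-zero degree). [folklore] -/
lemma isNilpotent_E (i : ι) : IsNilpotent (B.E i) := by
  have : Module.IsReflexive ℤ X := .of_isPerfPair P.toLinearMap
  have : IsAddTorsionFree X := .of_isTorsionFree ℤ X
  exact (B.isHomogMat_E i).isNilpotent (P.ne_zero i)

end RootRepBlock

/-! ### Families of blocks: the input of the group construction -/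

section Family

variable {J : Type*} [Fintype J] [DecidableEq J] {mb : J → Type*} [∀ j, Fintype (mb j)]
  [∀ j, DecidableEq (mb j)]

/-- The global weight function of a family of blocks. [folklore] -/
def sigmaWt {P : RootPairing ι ℤ X Y} (blk : ∀ j, RootRepBlock k P (mb j)) : (Σ j, mb j) → X :=
  fun x => (blk x.1).wt x.2

/-- The global (block-diagonal) root matrices of a family of blocks. [folklore] -/
def sigmaE {P : RootPairing ι ℤ X Y} (blk : ∀ j, RootRepBlock k P (mb j)) (i : ι) :
    Matrix (Σ j, mb j) (Σ j, mb j) k :=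
  Matrix.blockDiagonal' fun j => (blk j).E i

/-- The span `𝔤_V = 𝔱_V + ∑_α k E_α ≤ 𝔤𝔩(V)` of the torus Lie algebra and the root matrices.
[folklore] -/
def rootRepLie {P : RootPairing ι ℤ X Y} (blk : ∀ j, RootRepBlock k P (mb j)) :
    Submodule k (Matrix (Σ j, mb j) (Σ j, mb j) k) :=
  torusLie (sigmaWt blk) ⊔ Submodule.span k (Set.range (sigmaE blk))

/-- **The infinitesimal data of a split reductive group with based root datum `(P, b)`**, as used
by the group construction of Chevalley's existence theorem: a finite family of blocks
(`RootRepBlock`) such that the weights generate `X` (`wt_surjective`), block `j` is singled out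
by a weight `hw j` occurring in it and in no other block, the span `𝔤_V = 𝔱_V + ∑ k E_α` of the
torus Lie algebra and the global root matrices is closed under brackets, and every root matrix
lies in the Lie subalgebra generated by `𝔱_V` and the `E_{±α}` for `α` simple
(Springer 10.2.5–10.2.7; Steinberg §3, §5). [folklore] -/
structure RootRep (k : Type*) [Field k] (P : RootPairing ι ℤ X Y) (b : P.Base) (J : Type*)
    [Fintype J] [DecidableEq J] (mb : J → Type*) [∀ j, Fintype (mb j)]
    [∀ j, DecidableEq (mb j)] where
  /-- The blocks. -/
  blk : ∀ j, RootRepBlock k P (mb j)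
  /-- The weights generate `X`. -/
  wt_surjective : Function.Surjective (wtHom (sigmaWt blk))
  /-- A distinguishing weight of each block. -/
  hw : J → X
  /-- The distinguishing weight occurs in its block. -/
  exists_wt_eq_hw : ∀ j, ∃ a : mb j, (blk j).wt a = hw j
  /-- The distinguishing weight of a block occurs in no other block. -/
  wt_ne_hw : ∀ j j', j' ≠ j → ∀ a : mb j', (blk j').wt a ≠ hw j
  /-- `𝔤_V` is closed under brackets of root matrices. -/
  E_mul_E_sub_mem : ∀ i i', sigmaE blk i * sigmaE blk i' - sigmaE blk i' * sigmaE blk i ∈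
    rootRepLie blk
  /-- Every root matrix lies in the Lie algebra generated by `𝔱_V` and the simple `E_{±α}`. -/
  E_mem_lieSpan : ∀ i, sigmaE blk i ∈ LieSubalgebra.lieSpan k (Matrix (Σ j, mb j) (Σ j, mb j) k)
    ((torusLie (k := k) (sigmaWt blk) : Set (Matrix (Σ j, mb j) (Σ j, mb j) k)) ∪
      ⋃ i' ∈ b.support, {sigmaE blk i', sigmaE blk (P.reflectionPerm i' i')})

namespace RootRep

variable {P : RootPairing ι ℤ X Y} {b : P.Base} (D : RootRep k P b J mb)

/-- The global weights of the family. [folklore] -/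
abbrev wt : (Σ j, mb j) → X := sigmaWt D.blk

/-- The global root matrices of the family. [folklore] -/
abbrev E (i : ι) : Matrix (Σ j, mb j) (Σ j, mb j) k := sigmaE D.blk i

/-- The Lie algebra `𝔤_V` of the family. [folklore] -/
abbrev lie : Submodule k (Matrix (Σ j, mb j) (Σ j, mb j) k) := rootRepLie D.blk

/-- The global root matrices are block diagonal. [folklore] -/
lemma E_apply_of_ne (i : ι) {x y : Σ j, mb j} (h : x.1 ≠ y.1) : D.E i x y = 0 := by
  rcases x with ⟨j, a⟩
  rcases y with ⟨j', c⟩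
  exact Matrix.blockDiagonal'_apply_ne _ _ _ h

/-- **The global root matrix `E_α` is homogeneous of degree `α`.** [folklore] -/
lemma isHomogMat_E (i : ι) : IsHomogMat D.wt (P.root i) (D.E i) := by
  rintro ⟨j, a⟩ ⟨j', c⟩ h
  by_cases hjj : j = j'
  · subst hjj
    have h' : (D.blk j).E i a c ≠ 0 := by
      simpa [sigmaE, Matrix.blockDiagonal'_apply_eq] using h
    exact (D.blk j).isHomogMat_E i a c h'
  · exact (h (Matrix.blockDiagonal'_apply_ne _ _ _ hjj)).elim

/-- The global `H_α` is the block-diagonal matrix of the `H_α` of the blocks. [folklore] -/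
lemma hMat_eq_blockDiagonal' (i : ι) :
    hMat (k := k) P D.wt i = Matrix.blockDiagonal' fun j => hMat P (D.blk j).wt i :=
  (Matrix.blockDiagonal'_diagonal fun j (a : mb j) => corootForm (k := k) P i ((D.blk j).wt a)).symm

/-- The global `D_ℓ` is the block-diagonal matrix of the `D_ℓ` of the blocks. [folklore] -/
lemma torusDiag_eq_blockDiagonal' (ℓ : X →+ k) :
    torusDiag D.wt ℓ = Matrix.blockDiagonal' fun j => torusDiag (D.blk j).wt ℓ :=
  (Matrix.blockDiagonal'_diagonal fun j (a : mb j) => ℓ ((D.blk j).wt a)).symm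

/-- **`[E_α, E_{-α}] = H_α`** for the global root matrices. [folklore] -/
lemma E_mul_E_neg_sub (i : ι) :
    D.E i * D.E (P.reflectionPerm i i) - D.E (P.reflectionPerm i i) * D.E i = hMat P D.wt i := by
  rw [hMat_eq_blockDiagonal']
  simp only [RootRep.E, sigmaE]
  rw [← Matrix.blockDiagonal'_mul, ← Matrix.blockDiagonal'_mul, ← Matrix.blockDiagonal'_sub]
  congr 1
  funext j
  exact (D.blk j).E_mul_E_neg_sub i

/-- `[H_α, E_α] = 2 E_α` globally. [folklore] -/
lemma hMat_mul_E_sub (i : ι) :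
    hMat P D.wt i * D.E i - D.E i * hMat P D.wt i = (2 : k) • D.E i := by
  rw [hMat_mul_sub_mul_hMat P (D.isHomogMat_E i), corootForm_root_self]

/-- `[H_α, E_{-α}] = -2 E_{-α}` globally. [folklore] -/
lemma hMat_mul_E_neg_sub' (i : ι) :
    hMat P D.wt i * D.E (P.reflectionPerm i i) - D.E (P.reflectionPerm i i) * hMat P D.wt i =
      (-2 : k) • D.E (P.reflectionPerm i i) := by
  rw [hMat_mul_sub_mul_hMat P (D.isHomogMat_E _), P.root_reflectionPerm,
    P.reflection_apply_self, corootForm_neg_root_self]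

/-- The global root matrices are nilpotent. [folklore] -/
lemma isNilpotent_E (i : ι) : IsNilpotent (D.E i) := by
  have : Module.IsReflexive ℤ X := .of_isPerfPair P.toLinearMap
  have : IsAddTorsionFree X := .of_isTorsionFree ℤ X
  exact (D.isHomogMat_E i).isNilpotent (P.ne_zero i)

/-- `E_α ∈ 𝔤_V`. [folklore] -/
lemma E_mem_lie (i : ι) : D.E i ∈ D.lie :=
  Submodule.mem_sup_right (Submodule.subset_span ⟨i, rfl⟩)

/-- `𝔱_V ≤ 𝔤_V`. [folklore] -/
lemma torusLie_le_lie : torusLie D.wt ≤ D.lie := le_sup_left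

/-- `D_ℓ ∈ 𝔤_V`. [folklore] -/
lemma torusDiag_mem_lie (ℓ : X →+ k) : torusDiag D.wt ℓ ∈ D.lie :=
  D.torusLie_le_lie (torusDiag_mem_torusLie ℓ)

/-- `H_α ∈ 𝔤_V`. [folklore] -/
lemma hMat_mem_lie (i : ι) : hMat (k := k) P D.wt i ∈ D.lie := D.torusDiag_mem_lie _

/-- **The coroot form is non-zero on some weight**: since the weights generate `X` and
`⟨α, α^∨⟩ = 2 ≠ 0` in characteristic `0`, some `⟨wt a, α^∨⟩ ≠ 0` in `k`. [folklore] -/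
lemma exists_corootForm_wt_ne_zero [CharZero k] (i : ι) :
    ∃ a, corootForm (k := k) P i (D.wt a) ≠ 0 := by
  by_contra hcon
  push Not at hcon
  have hall : ∀ x : X, corootForm (k := k) P i x = 0 := by
    intro x
    obtain ⟨v, rfl⟩ := D.wt_surjective x
    rw [wtHom_apply, map_sum]
    refine Finset.sum_eq_zero fun a _ => ?_
    rw [map_zsmul, hcon a, smul_zero]
  have h2 := hall (P.root i)
  rw [corootForm_root_self] at h2
  exact two_ne_zero h2

/-- **`H_α ≠ 0`.** [folklore] -/
lemma hMat_ne_zero [CharZero k] (i : ι) : hMat (k := k) P D.wt i ≠ 0 := by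
  obtain ⟨a, ha⟩ := D.exists_corootForm_wt_ne_zero i
  intro h
  have := congrFun (congrFun h a) a
  rw [hMat, torusDiag_apply, if_pos rfl] at this
  exact ha this

/-- **The global root matrices are non-zero** (`[E_α, E_{-α}] = H_α ≠ 0`). [folklore] -/
theorem E_ne_zero [CharZero k] (i : ι) : D.E i ≠ 0 := by
  intro h
  apply D.hMat_ne_zero i
  rw [← D.E_mul_E_neg_sub i, h, zero_mul, mul_zero, sub_zero]

/-- The weight `hw j` singles out the block `j`: a basis vector of weight `hw j` lies in block `j`.
[folklore] -/
lemma fst_eq_of_wt_eq_hw {j : J} {x : Σ j, mb j} (hx : D.wt x = D.hw j) : x.1 = j := by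
  by_contra h
  exact D.wt_ne_hw j x.1 h x.2 hx

end RootRep

end Family

end Literature.NumberTheory.Automorphic
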